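import Mathlib
import HarnessLib

/-!
# Route `KLProgramme` — crux K3, the nested two-volume pass: BLOCK COVARIANCE of a substitution kernel collapses the box sums of the deep-pin bracket
# to plain column sums (cell gate-hubbard-kl, seat hubbard-kl-k3c4-p1 g8; `--supports` stmt-…-20440)

The substitution–gluing bracket at a deep pin (`…TwoVolumeSubstitutionGluingDeepPin`, `…Bound`, `…Winding`) carries two «box-collapsed» hypotheses on the fine
substitution kernel `t x′ Y′ = ‖T′ x′ Y′‖`: `hwin : Σ_β Σ_{x′ ∈ box β′} t x′ (e₁⁻¹(β, y)) ≤ a` and the winding tail `hτ₄ : Σ_{β ≠ β₀} Σ_{x′ ∈ box β₀} t x′ (e₁⁻¹(β, y)) ≤ τ`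
for deep `y`.  For a kernel that is BLOCK COVARIANT — `t (e₂⁻¹(β′ + δ, x̄)) (e₁⁻¹(β + δ, y)) = t (e₂⁻¹(β′, x̄)) (e₁⁻¹(β, y))` for every block shift `δ` (the model's
spatial translation covariance `…TwoVolumeSectorOverlapPeriodisation.sectorOverlap_translate` read through the block structures: shifting both labels by the
box-lattice vector `L·δ`) — these are EXACTLY the plain column sum and the plain column tail outside the box:

* `sum_box_eq_sum_coarse` — a box of the fine out-labels is indexed by the coarse out-labels;
* **`sum_blocks_sum_box_eq_colSum`** — `Σ_β Σ_{x′ ∈ box β′} t x′ (e₁⁻¹(β, y)) = Σ_{x′} t x′ (e₁⁻¹(β₀, y))` (any `β′, β₀`);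
* **`sum_blocks_erase_sum_box_eq_colOut`** — `Σ_{β ≠ β₀} Σ_{x′ ∈ box β₀} t x′ (e₁⁻¹(β, y)) = Σ_{x′ ∉ box β₀} t x′ (e₁⁻¹(β₀, y))`.

So under block covariance `hwin` is the column-sum hypothesis and `hτ₄` is `hτ₁` of the bracket.  Generic (blocks `ι` any finite additive group, e.g.
`Fin 2 → Fin b`); everything is proved; no definition.
-/

noncomputable section

namespace Summit.HubbardSuperconductivity.HubbardSuperconductivity.Theorems.TwoVolumeDefect

set_option linter.dupNamespace false -- summit = problem name (single-conjunct summit), D-0017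

open Finset

variable {ι Γ₁ Γ₂ Γ₁' Γ₂' : Type*} [Fintype ι] [DecidableEq ι] [Fintype Γ₂] [Fintype Γ₂']

omit [Fintype ι] [DecidableEq ι] in
/-- **A box of the fine out-labels is indexed by the coarse out-labels**: `Σ_{x′ : blk x′ = β′} g x′ = Σ_{x̄} g (e₂⁻¹(β′, x̄))`. [folklore] -/
theorem sum_box_eq_sum_coarse [DecidableEq ι] (e₂ : Γ₂' ≃ ι × Γ₂) (β' : ι) (g : Γ₂' → ℝ) :
    ∑ x' ∈ univ.filter (fun x' : Γ₂' => (e₂ x').1 = β'), g x' = ∑ xbar : Γ₂, g (e₂.symm (β', xbar)) := by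
  classical
  refine Finset.sum_nbij' (fun x' => (e₂ x').2) (fun xbar => e₂.symm (β', xbar)) ?_ ?_ ?_ ?_ ?_
  · intro x' _; exact mem_univ _
  · intro xbar _
    simp only [mem_filter, mem_univ, true_and, Equiv.apply_symm_apply]
  · intro x' hx'
    simp only [mem_filter, mem_univ, true_and] at hx'
    rw [← hx', Prod.mk.eta, Equiv.symm_apply_apply]
  · intro xbar _
    simp only [Equiv.apply_symm_apply]
  · intro x' hx'
    simp only [mem_filter, mem_univ, true_and] at hx'
    rw [← hx', Prod.mk.eta, Equiv.symm_apply_apply]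

/-- **Box-collapsed column sums of a block-covariant kernel are plain column sums**: if
`t (e₂⁻¹(β′ + δ, x̄)) (e₁⁻¹(β + δ, y)) = t (e₂⁻¹(β′, x̄)) (e₁⁻¹(β, y))` for all block shifts `δ`, then for every `β′, β₀, y`:
`Σ_β Σ_{x′ : blk x′ = β′} t x′ (e₁⁻¹(β, y)) = Σ_{x′} t x′ (e₁⁻¹(β₀, y))` (the hypothesis `hwin` of the deep-pin bracket from the column sum). [folklore] -/
theorem sum_blocks_sum_box_eq_colSum [AddCommGroup ι] (e₁ : Γ₁' ≃ ι × Γ₁) (e₂ : Γ₂' ≃ ι × Γ₂) (t : Γ₂' → Γ₁' → ℝ)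
    (hcov : ∀ (δ β' β : ι) (xbar : Γ₂) (y : Γ₁), t (e₂.symm (β' + δ, xbar)) (e₁.symm (β + δ, y)) = t (e₂.symm (β', xbar)) (e₁.symm (β, y)))
    (β' β₀ : ι) (y : Γ₁) :
    ∑ β : ι, ∑ x' ∈ univ.filter (fun x' : Γ₂' => (e₂ x').1 = β'), t x' (e₁.symm (β, y)) = ∑ x' : Γ₂', t x' (e₁.symm (β₀, y)) := by
  classical
  -- each box sum, indexed by the coarse out-labels, shifted to the reference block `β₀`
  have hbox : ∀ β : ι, ∑ x' ∈ univ.filter (fun x' : Γ₂' => (e₂ x').1 = β'), t x' (e₁.symm (β, y)) =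
      ∑ xbar : Γ₂, t (e₂.symm (β' + (β₀ - β), xbar)) (e₁.symm (β₀, y)) := by
    intro β
    rw [sum_box_eq_sum_coarse e₂ β']
    refine sum_congr rfl fun xbar _ => ?_
    have h := hcov (β₀ - β) β' β xbar y
    rw [add_sub_cancel] at h
    exact h.symm
  simp_rw [hbox]
  -- reindex the blocks by `β ↦ β′ + (β₀ − β)` and glue the boxes back
  calc ∑ β : ι, ∑ xbar : Γ₂, t (e₂.symm (β' + (β₀ - β), xbar)) (e₁.symm (β₀, y))
      = ∑ β'' : ι, ∑ xbar : Γ₂, t (e₂.symm (β'', xbar)) (e₁.symm (β₀, y)) := by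
        refine Finset.sum_nbij' (fun β => β' + (β₀ - β)) (fun β'' => β' + β₀ - β'') ?_ ?_ ?_ ?_ ?_
        · intro β _; exact mem_univ _
        · intro β'' _; exact mem_univ _
        · intro β _; abel
        · intro β'' _; abel
        · intro β _; rfl
    _ = ∑ x' : Γ₂', t x' (e₁.symm (β₀, y)) := by
        rw [← Fintype.sum_prod_type']
        exact Fintype.sum_equiv e₂.symm _ _ fun q => rfl

/-- **The winding columns of a block-covariant kernel are the column outside the box**:
`Σ_{β ≠ β₀} Σ_{x′ : blk x′ = β₀} t x′ (e₁⁻¹(β, y)) = Σ_{x′ : blk x′ ≠ β₀} t x′ (e₁⁻¹(β₀, y))` (the winding tail `hτ₄` of the deep-pin bracket from the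
column tail `hτ₁`). [folklore] -/
theorem sum_blocks_erase_sum_box_eq_colOut [AddCommGroup ι] (e₁ : Γ₁' ≃ ι × Γ₁) (e₂ : Γ₂' ≃ ι × Γ₂) (t : Γ₂' → Γ₁' → ℝ)
    (hcov : ∀ (δ β' β : ι) (xbar : Γ₂) (y : Γ₁), t (e₂.symm (β' + δ, xbar)) (e₁.symm (β + δ, y)) = t (e₂.symm (β', xbar)) (e₁.symm (β, y)))
    (β₀ : ι) (y : Γ₁) :
    ∑ β ∈ univ.erase β₀, ∑ x' ∈ univ.filter (fun x' : Γ₂' => (e₂ x').1 = β₀), t x' (e₁.symm (β, y)) =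
      ∑ x' ∈ univ.filter (fun x' : Γ₂' => (e₂ x').1 ≠ β₀), t x' (e₁.symm (β₀, y)) := by
  classical
  have hbox : ∀ β : ι, ∑ x' ∈ univ.filter (fun x' : Γ₂' => (e₂ x').1 = β₀), t x' (e₁.symm (β, y)) =
      ∑ xbar : Γ₂, t (e₂.symm (β₀ + (β₀ - β), xbar)) (e₁.symm (β₀, y)) := by
    intro β
    rw [sum_box_eq_sum_coarse e₂ β₀]
    refine sum_congr rfl fun xbar _ => ?_
    have h := hcov (β₀ - β) β₀ β xbar y
    rw [add_sub_cancel] at h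
    exact h.symm
  simp_rw [hbox]
  -- both sides are the sum over all fine out-labels minus the box `β₀`
  have hall := sum_blocks_sum_box_eq_colSum e₁ e₂ t hcov β₀ β₀ y
  simp_rw [hbox] at hall
  rw [← Finset.add_sum_erase univ _ (mem_univ β₀)] at hall
  rw [← Finset.sum_filter_add_sum_filter_not univ (fun x' : Γ₂' => (e₂ x').1 = β₀)] at hall
  have hb0 : ∑ xbar : Γ₂, t (e₂.symm (β₀ + (β₀ - β₀), xbar)) (e₁.symm (β₀, y)) =
      ∑ x' ∈ univ.filter (fun x' : Γ₂' => (e₂ x').1 = β₀), t x' (e₁.symm (β₀, y)) := by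
    rw [sub_self, add_zero, sum_box_eq_sum_coarse e₂ β₀]
  rw [hb0] at hall
  linarith

end Summit.HubbardSuperconductivity.HubbardSuperconductivity.Theorems.TwoVolumeDefect

end
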